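import Mathlib.MeasureTheory.Measure.Real
import Literature.Geometry.Lorentzian.VolumeProofs
import Literature.Geometry.Riemannian.KarpukhinSternReduction
import HarnessLib

/-!
# Upper volume bound `Vol B(p, r) ≤ C rⁿ` for all balls of a closed Riemannian manifold

For a Riemannian metric `g` (a positive definite `PseudoRiemannianMetric`) on a compact
boundaryless manifold `M` of dimension `n = dim E` we prove the classical, metric-dependent
estimate

  `Vol_g {w | d_g(p, w) < r} ≤ C · rⁿ`   for all `p ∈ M` and all `r > 0`,

with one constant `C = C(M, g) > 0` (`exists_riemVolume_real_ball_le_mul_pow_of_compactSpace`,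
general model; `exists_riemVolume_ball_le_mul_pow`, the registered form for manifolds modelled on
`ℝᵐ = EuclideanSpace ℝ (Fin m)`). Here `d_g = g.edist hg` is the Riemannian (length) distance and
`Vol_g = g.riemVolume` the Riemannian measure (the Euclidean-normalised `n`-dimensional Hausdorff
measure `μHE[n] = σₙ • μH[n]` of `d_g`, `CanonicalNeighbourhoods.lean`, `Volume.lean`).

## Proof

Small radii: charts are locally bi-Lipschitz for the length distance, so a small ball `B(p, r)`
is the image under the inverse chart (Lipschitz, expanding `μH[n]` by at most `Kⁿ`, Federer 1969,
§2.10.11) of a subset of the norm ball `B(φ p, K₁ r)` of the model space, whose Hausdorff measure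
is `(K₁ r)ⁿ μH[n](B(0, 1))` (Haar scaling); uniformly for all centres by compactness — this is
`KarpukhinStern.exists_hausdorffMeasure_eball_le_mul_pow_of_isCompact` (the upper companion of
`VolumeSmallBalls.lean`), giving `μH[n](B(p, r)) ≤ c rⁿ` for `0 < r ≤ ρ`. Large radii `r > ρ`:
`Vol B(p, r) ≤ Vol(M) < ∞` (`riemannianVolume_lt_top_of_isCompact_holds`) and
`Vol(M) ≤ (Vol(M) / ρⁿ) rⁿ`. The constant is `C = σₙ c + Vol(M)/ρⁿ + 1`.

## References

* I. Chavel, *Riemannian Geometry: A Modern Introduction*, 2nd ed., CUP 2006, §III.3 (volume of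
  metric disks in charts). [Chavel2006]
* H. Federer, *Geometric Measure Theory*, Springer 1969, §2.10.11 (Lipschitz maps and `H^m`),
  §3.2.46 (Riemannian manifolds). [Federer1969]
* D. Burago, Yu. Burago, S. Ivanov, *A course in metric geometry*, AMS 2001, §5.1 (charts are
  locally bi-Lipschitz for the length metric).
-/

noncomputable section

open Set Filter Function MeasureTheory Measure Module Manifold Bundle
open scoped Manifold ContDiff Topology ENNReal NNReal

namespace Literature.Geometry.Riemannian

open Lorentzian Lorentzian.PseudoRiemannianMetric

section General

variable {E : Type*} [NormedAddCommGroup E] [NormedSpace ℝ E] [FiniteDimensional ℝ E]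
  {H : Type*} [TopologicalSpace H] {I : ModelWithCorners ℝ E H} [I.Boundaryless]
  {M : Type*} [TopologicalSpace M] [ChartedSpace H M] [IsManifold I ∞ M] {n : ℕ∞ω}
  [T3Space M] [MeasurableSpace M] [BorelSpace M] [CompactSpace M]

/-- **Balls of a closed Riemannian manifold have volume at most `C · rⁿ`** (general model): for a
Riemannian `g` on a compact boundaryless manifold `M` of dimension `n = dim E` there is
`C = C(M, g) > 0` with `Vol_g {w | d_g(p, w) < r} ≤ C rⁿ` for every centre `p` and every radius
`r > 0`. Small radii: the local bi-Lipschitz comparison of the length distance with the chart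
distance and Haar scaling in the model space, uniformly by compactness
(`KarpukhinStern.exists_hausdorffMeasure_eball_le_mul_pow_of_isCompact`; Chavel 2006, §III.3;
Federer 1969, §2.10.11); large radii: the total volume is finite. [folklore] -/
theorem exists_riemVolume_real_ball_le_mul_pow_of_compactSpace
    {g : PseudoRiemannianMetric I n E (TangentSpace I : M → Type _)} (hg : g.IsRiemannian) :
    ∃ C : ℝ, 0 < C ∧ ∀ (p : M) (r : ℝ), 0 < r →
      g.riemVolume.real {w | g.edist hg p w < ENNReal.ofReal r} ≤ C * r ^ finrank ℝ E := by
  letI : RiemannianBundle (fun x : M ↦ TangentSpace I x) :=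
    ⟨(g.toContMDiffRiemannianMetric hg).toContinuousRiemannianMetric.toRiemannianMetric⟩
  letI := EMetricSpace.ofRiemannianMetric I M
  -- small balls: `μH[n] (B(p, r)) ≤ c rⁿ` for `0 < r ≤ ρ`, uniformly in `p`
  obtain ⟨c, ρ, hρ, hle⟩ :=
    KarpukhinStern.exists_hausdorffMeasure_eball_le_mul_pow_of_isCompact (I := I)
      (isCompact_univ (X := M))
  -- the volume is `σ • μH[n]`, the balls are the `eball`s of the length distance
  set σ : ℝ≥0 := addHaarScalarFactor (volume : Measure (EuclideanSpace ℝ (Fin (finrank ℝ E))))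
    (μH[finrank ℝ E] : Measure (EuclideanSpace ℝ (Fin (finrank ℝ E)))) with hσ
  have hvol : ∀ s : Set M, g.riemVolume s = (σ : ℝ≥0∞) * μH[finrank ℝ E] s := by
    intro s
    rw [PseudoRiemannianMetric.riemVolume_eq hg]
    show (μHE[finrank ℝ E] : Measure M) s = _
    rw [Measure.euclideanHausdorffMeasure_def, Measure.smul_apply, ENNReal.smul_def, smul_eq_mul]
  have hball : ∀ (p : M) (r : ℝ≥0∞), {w | g.edist hg p w < r} = Metric.eball p r := by
    intro p r
    ext y
    rw [Metric.mem_eball']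
    rfl
  -- the total volume `V` is finite
  have hfin : g.riemVolume (univ : Set M) ≠ ⊤ := by
    rw [PseudoRiemannianMetric.riemVolume_eq hg]
    exact (riemannianVolume_lt_top_of_isCompact_holds (g.toContMDiffRiemannianMetric hg) le_rfl
      isCompact_univ).ne
  set V : ℝ := g.riemVolume.real (univ : Set M) with hV
  have hV0 : 0 ≤ V := measureReal_nonneg
  have hA0 : 0 ≤ (σ : ℝ) * c := by positivity
  have hB0 : 0 ≤ V / ρ ^ finrank ℝ E := div_nonneg hV0 (pow_nonneg hρ.le _)
  refine ⟨(σ : ℝ) * c + V / ρ ^ finrank ℝ E + 1, by linarith, fun p r hr ↦ ?_⟩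
  have hrn : 0 ≤ r ^ finrank ℝ E := pow_nonneg hr.le _
  rcases le_or_gt r ρ with hrρ | hrρ
  · -- small radius
    have h1 : g.riemVolume.real {w | g.edist hg p w < ENNReal.ofReal r} ≤
        (σ : ℝ) * c * r ^ finrank ℝ E := by
      rw [measureReal_def, hvol, hball]
      have hfin' : (σ : ℝ≥0∞) * ((c : ℝ≥0∞) * ENNReal.ofReal (r ^ finrank ℝ E)) ≠ ⊤ :=
        ENNReal.mul_ne_top ENNReal.coe_ne_top
          (ENNReal.mul_ne_top ENNReal.coe_ne_top ENNReal.ofReal_ne_top)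
      calc ((σ : ℝ≥0∞) * μH[finrank ℝ E] (Metric.eball p (ENNReal.ofReal r))).toReal
          ≤ ((σ : ℝ≥0∞) * ((c : ℝ≥0∞) * ENNReal.ofReal (r ^ finrank ℝ E))).toReal :=
            ENNReal.toReal_mono hfin' (mul_le_mul' le_rfl (hle p (mem_univ p) r hr hrρ))
        _ = (σ : ℝ) * c * r ^ finrank ℝ E := by
            rw [ENNReal.toReal_mul, ENNReal.toReal_mul, ENNReal.coe_toReal, ENNReal.coe_toReal,
              ENNReal.toReal_ofReal hrn, mul_assoc]
    calc g.riemVolume.real {w | g.edist hg p w < ENNReal.ofReal r}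
        ≤ (σ : ℝ) * c * r ^ finrank ℝ E := h1
      _ ≤ ((σ : ℝ) * c + V / ρ ^ finrank ℝ E + 1) * r ^ finrank ℝ E :=
          mul_le_mul_of_nonneg_right (by linarith) hrn
  · -- large radius: compare with the total volume
    have h1 : g.riemVolume.real {w | g.edist hg p w < ENNReal.ofReal r} ≤ V :=
      measureReal_mono (subset_univ _) hfin
    have hρn : 0 < ρ ^ finrank ℝ E := pow_pos hρ _
    have h2 : ρ ^ finrank ℝ E ≤ r ^ finrank ℝ E := pow_le_pow_left₀ hρ.le hrρ.le _
    have h3 : V ≤ V / ρ ^ finrank ℝ E * r ^ finrank ℝ E := by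
      rw [div_mul_eq_mul_div, le_div_iff₀ hρn]
      exact mul_le_mul_of_nonneg_left h2 hV0
    calc g.riemVolume.real {w | g.edist hg p w < ENNReal.ofReal r} ≤ V := h1
      _ ≤ V / ρ ^ finrank ℝ E * r ^ finrank ℝ E := h3
      _ ≤ ((σ : ℝ) * c + V / ρ ^ finrank ℝ E + 1) * r ^ finrank ℝ E :=
          mul_le_mul_of_nonneg_right (by linarith) hrn

end General

/-! ### The registered statement -/

/-- **Upper volume bound for balls of a closed Riemannian `m`-manifold**: for a smooth
Riemannian metric `g` on a compact manifold modelled on `ℝᵐ = EuclideanSpace ℝ (Fin m)` there is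
`C = C(M, g) > 0` with `Vol_g {w | d_g(p, w) < r} ≤ C rᵐ` for all `p` and all `r > 0` (the
constant depends on the metric; this is the easy direction of the Euclidean volume growth of small
balls, Chavel 2006, §III.3, extended to all radii by `Vol B ≤ Vol(M) < ∞`). The binders are those
of the registered stub; `[T2Space M]`, `[SecondCountableTopology M]` and `[ConnectedSpace M]` are
not used. [folklore] -/
theorem exists_riemVolume_ball_le_mul_pow {m : ℕ} {M : Type*} [TopologicalSpace M]
    [ChartedSpace (EuclideanSpace ℝ (Fin m)) M] [IsManifold 𝓘(ℝ, EuclideanSpace ℝ (Fin m)) ∞ M]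
    [T2Space M] [CompactSpace M] [SecondCountableTopology M] [MeasurableSpace M] [BorelSpace M]
    [ConnectedSpace M] [T3Space M]
    (g : PseudoRiemannianMetric 𝓘(ℝ, EuclideanSpace ℝ (Fin m)) ∞ (EuclideanSpace ℝ (Fin m))
      (TangentSpace 𝓘(ℝ, EuclideanSpace ℝ (Fin m)) : M → Type _)) (hg : g.IsRiemannian) :
    ∃ C : ℝ, 0 < C ∧ ∀ (p : M) (r : ℝ), 0 < r →
      g.riemVolume.real {w | g.edist hg p w < ENNReal.ofReal r} ≤ C * r ^ m := by
  have h := exists_riemVolume_real_ball_le_mul_pow_of_compactSpace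
    (I := 𝓘(ℝ, EuclideanSpace ℝ (Fin m))) hg
  rwa [finrank_euclideanSpace_fin] at h

end Literature.Geometry.Riemannian

end
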